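import Literature.MathematicalPhysics.QuantumFieldTheory.Balaban1983to89.B9B8KnitFlatAveragingAgreement

/-!
# `Balaban1983to89.B9B8KnitAveragingClosenessOfColumns` — the (B)-line bond junction, file c6 (skeleton): THE AVERAGING CLOSENESS (c′) FROM TWO
# COLUMN-LEVEL INEQUALITIES — if at a background `U₀` (in [5]'s regime (1.7)) every COLUMN of the knit's composite linear averaging at the window bonds is
# `δ₁`-close to def-Y's flat entry times def-Y's transport (`Lⁿ·qK ι f·R(qT parB U ι f)`), and the knit's class field at the window bonds is `δ₂`-close to
# `ηLⁿ·(Q(U)a)(ι)`, then `Q*(U)aQ(U)a` and `(c_fη)²·(QQZdP(U₀)a♯)♭` are `ε`-close bond by bond with `ε = (c_fη)²·w_n·2(d+1)·C_τβ_τ·(δ₁C₃ + Lⁿδ₂)`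

statement-level skeleton of published theorems with citation tags; proofs where landed; nothing here is a claim about the
Yang–Mills mass gap

Sub-row G-B8-T2S (unit `lit-balaban-t2s-1`, gen 7), RULING #10 road, crux (c′) (design `lit-balaban-t2s-1/g7/BLINE-DESIGN-g7.md` §2–§3; `g7/NOTES-g7.md`
«c6 plan»).  The flat agreement (`B9B8KnitFlatAveragingAgreement`, `ε_Q = 0` at `U₀ = 1`) fixes the normalisations; this file is the PERTURBATIVE frame of
the curved case: the two sides are compared window bond by window bond through c1's transpose bookkeeping (`entryT_smul_conjR`: the `τ`-transpose of
`X ↦ m·R(T)X` is `m·R(T⁻¹)`, which IS def-Y's `Q*(U)` entry with the inverse transporter; `norm_entryT_pair_sub_le`).  What remains DISPLAYED are the two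
column-level inequalities (H1) (columns: [5] (139)–(147) on bumps + the main-term transports versus def-Y's `qT`) and (H2) (class field: the forward
direction), and a size bound (H3) of the class field — the c4 ∕ c5 files of the design.
Print: [4] (3.12)–(3.13) pp. 392–393, (3.16) p. 393, (3.26) p. 395; [B8] (1.58) p. 86, (1.7) p. 77; [5] (139)–(147) pp. 39–40, (124)–(127) pp. 36–37.

WHAT IS PROVED (kernel, 0 sorry; theorems only, no `def`, no `… : Prop` fact, no `instance`).
* §1 `QsY_apply` (`(Q*(U)Λ)(f) = Σ_ι qK ι f·R((qT ι f)⁻¹)Λ(ι)`), `abs_qK_le_one`, `norm_R_le_of_mem_unitaryUnits`, `wQ_nonneg'`.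
* §2 ★★★ `norm_QsY_aY_QY_sub_QQZdP_le_of_columns` — (c′) AT ONE FINE BOND FROM (H1)–(H3) (and ★★★ `…_sharp`: the `δ₂`-term at the entry scale `L^{-nd}`
  instead of `Lⁿ` — the edition whose `ε` is uniform in `n`): for a constant-level-`n` member with the `b₀ = 1` band weight,
  unitary def-Y transporters `qT parB U · f`, a background `U₀` in the regime `Reg17 L n ℤ^{d+1} (α_Q∕L²)`, a faithful tracial `τ` with `|Re τ(x*y)| ≤ C_τ‖x‖‖y‖`:
  `‖(Q*(U)aQ(U)a)(f) − (c_fη)²·(QQZdP(U₀)a♯)♭(f)‖ ≤ (c_fη)²·w_n·(2(d+1)·C_τβ_τ·(δ₁C₃ + Lⁿδ₂))·‖a‖`.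

HONEST SCOPE.  Perturbative frame only: (H1)–(H3) are DISPLAYED (their suppliers are the design's c4 ∕ c5); no estimate of [5] is proved here; count-neutral;
nothing continuum ∕ ℝ⁴ ∕ OS ∕ mass gap ∕ Clay — the Yang–Mills mass gap is NOT proved here.  NEW file; c1, c2 I–IV are used BY NAME, nothing landed is modified.
-/

noncomputable section

namespace Literature.MathematicalPhysics.QuantumFieldTheory.Balaban1983to89.B9B8KnitAveragingClosenessOfColumns

open scoped BigOperators
open Node00
open B7Prop1Explicit renaming Site → LSite
open B7Prop1Explicit (e e_apply)
open B7Prop2Explicit (unitaryUnits)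
open B6KLevelCensusIndexV1 (KIdx)
open B6GlobalChartV1 (PV)
open B7Prop4GeneralLevels (linCovIter)
open B7Prop5Flat (bump)
open B7Eq78Linearization (conjR)
open B10Eq27TorusAxialLog (transl transl_apply rel transl_rel)
open B9B8KnitBondTransfer (liftBd liftBd_apply descBd descBd_apply)
open B9B8KnitBondAvgColumns (exists_ibondY_of_constLev)
open B9B8KnitBondAvgSupport (ibondY_eq_of_key_eq dir_eq_of_qK_ne_zero src_eq_winBase_of_qK_ne_zero clsField_of_ne)
open B9B8KnitFlatAveragingAgreement (aY_apply transl_winBase_injective)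
open B8Thm2TorusMemberWeighted (ibondY_level_eq)
open B9B8KnitKernelTranspose (entryT_smul_conjR norm_entryT_pair_sub_le)
open B9Eq316AveragingTransposeZd (entryT betaTau winBase clsField wQ linCovIterT alphaQ Reg17)
open B9Eq316AveragingTransposeZdPrinted (QQZdP QQZdP_of_reg17)
open B9Eq332AveragingLetterCovarianceZd (entryT_zero')
open B8Thm2TorusMember (TorusMember torusIdx torusLamb)
open B9Eq39Adjoint (R R_smul)
open B9Eq310Hermitian (norm_R_le)
open B6Ineq2142KLevelV1 (qwt_le qwt_nonneg)
open B9Eq3132Ineq2142Covariant (qK_apply)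

variable {d ℓ : ℕ} {hd : 1 ≤ d + 1} {hL : Odd (ℓ + 1) ∧ 1 < ℓ + 1} {b₀ b₁ : ℝ}

/-! ## §1 Small lemmas -/

section Small

variable {𝔸 : Type} [NormedRing 𝔸] [NormedAlgebra ℂ 𝔸] [CompleteSpace 𝔸] (i : KIdx d ℓ hd hL b₀ b₁)

/-- `(Q*(U)Λ)(f) = Σ_ι qK ι f·R((qT ι f)⁻¹)Λ(ι)` (`qsK = qKᵀ`). [cite: Balaban1985BackgroundPropagators, (3.13) p.393] -/
theorem QsY_apply (parB : BondParY 𝔸 i) (U : CfgY 𝔸 i) (Λ : IBondY i → 𝔸) (f : FBondY i) :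
    QsY i parB U Λ f = ∑ ι, ((qK i ι f : ℝ) : ℂ) • R (qT i parB U ι f)⁻¹ (Λ ι) := by
  rw [QsY, trLiftY_apply]
  refine Finset.sum_congr rfl fun ι _ => ?_
  rw [qsK_eq_transpose, Matrix.transpose_apply]

omit [CompleteSpace 𝔸] in
/-- `0 ≤ qK ι f ≤ 1`. [cite: Balaban1984PropagatorsI, (1.18) p.20] -/
theorem abs_qK_le_one (ι : IBondY i) (f : FBondY i) : |qK i ι f| ≤ 1 := by
  rw [qK_apply, abs_of_nonneg (qwt_nonneg i.hN i.D i.hk ι f)]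
  refine (qwt_le i.hN i.D i.hk ι f).trans ?_
  have h1 : (1 : ℝ) ≤ ((((ℓ + 1 : ℕ) : ℝ)) ^ (d + 1)) ^ (B6Ineq2142KLevelV1.lvl i.hN i.D i.hk ι) :=
    one_le_pow₀ (one_le_pow₀ (by exact_mod_cast Nat.succ_le_succ (Nat.zero_le ℓ)))
  exact inv_le_one_of_one_le₀ h1

end Small

section SmallC

variable {𝔸 : Type} [CStarAlgebra 𝔸] [Nontrivial 𝔸]

/-- transport by a unitary does not increase the norm: `‖R(T)X‖ ≤ ‖X‖`. [cite: Balaban1985Averaging, p.18 («U(N)»), folklore] -/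
theorem norm_R_le_of_mem_unitaryUnits {T : 𝔸ˣ} (hT : T ∈ unitaryUnits 𝔸) (X : 𝔸) : ‖R T X‖ ≤ ‖X‖ := by
  have hn : ∀ u : 𝔸ˣ, u ∈ unitaryUnits 𝔸 → ‖(u : 𝔸)‖ ≤ 1 := fun u hu =>
    (CStarRing.norm_coe_unitary ⟨(u : 𝔸), hu⟩).le
  exact norm_R_le (hn T hT) (hn T⁻¹ (Subgroup.inv_mem _ hT)) X

/-- `w_n ≥ 0`. [cite: Balaban1985RegularSpaces, (1.58) p.86, bookkeeping] -/
theorem wQ_nonneg' (L : ℕ) {η : ℝ} (hη : 0 ≤ η) (j : ℕ) : 0 ≤ wQ (d := d + 1) L η j := by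
  unfold wQ; positivity

end SmallC

/-! ## §2 The averaging closeness at one fine bond from the column-level inequalities -/

section Closeness

variable {𝔸 : Type} [CStarAlgebra 𝔸] [Nontrivial 𝔸] [FiniteDimensional ℝ 𝔸] (τ : 𝔸 →ₗ[ℂ] ℂ) (i : KIdx d ℓ hd hL b₀ b₁) {n : ℕ}

/-- ★★★ **THE AVERAGING CLOSENESS (c′) AT ONE FINE BOND FROM TWO COLUMN-LEVEL INEQUALITIES.**  Data: a member of constant level `n` (nominal index `n + 1`)
with the `b₀ = 1` band weight; def-Y transporters `parB` with unitary `qT parB U ι f`; a background `U₀` in the regime `Reg17 L n ℤ^{d+1} (α_Q∕L²)` (so the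
knit's letter is its printed sum); a faithful tracial `τ` with `|Re τ(x*y)| ≤ C_τ‖x‖‖y‖`; a bond function `a`, a fine bond `f = ⟨0 + y, μ⟩` (`y = rel 0 f₋`).
Hypotheses, for every index bond `ι` over a window bond `(winBase L n y κ t, κ)`: (H1) `‖LⁿQ_n(U₀)(bump y μ X)(winBase…, κ) − (Lⁿ·qK ι f)·R(qT parB U ι f)X‖ ≤ δ₁‖X‖`;
(H2) (`κ = μ`) `‖clsField(U₀, a♯)(winBase…, μ) − ηLⁿ·(Q(U)a)(ι)‖ ≤ δ₂‖a‖`; (H3) `‖clsField(U₀, a♯)(winBase…, κ)‖ ≤ C₃‖a‖`.  Conclusion: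
`‖(Q*(U)aQ(U)a)(f) − (c_fη)²·(QQZdP(U₀)a♯)♭(f)‖ ≤ (c_fη)²·w_n·(2(d+1)·C_τβ_τ·(δ₁C₃ + Lⁿδ₂))·‖a‖`.
[cite: Balaban1985BackgroundPropagators, (3.12)–(3.13) p.392, (3.16) p.393, (3.26) p.395; Balaban1985RegularSpaces, (1.58) p.86, (1.7) p.77; Balaban1985Averaging, (139)–(147) pp.39–40] -/
theorem norm_QsY_aY_QY_sub_QQZdP_le_of_columns (hτp : ∀ a : 𝔸, a ≠ 0 → 0 < (τ (star a * a)).re) (hτt : ∀ a b : 𝔸, τ (a * b) = τ (b * a))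
    {Cτ : ℝ} (hCτ : ∀ x y : 𝔸, |(τ (star x * y)).re| ≤ Cτ * ‖x‖ * ‖y‖)
    (hD : ∀ x, i.D.lev x = n) (hk : i.k = n + 1)
    (hw : ∀ ι : IBondY i, i.w ι = i.cf ^ 2 * (((((ℓ + 1 : ℕ) : ℝ)) ^ (ι.1.1 : ℕ)) ^ (d + 1) * (1 / (((ℓ + 1 : ℕ) : ℝ)) ^ (ι.1.1 : ℕ)) ^ 2))
    (hL1 : 1 ≤ ℓ + 1) {η : ℝ} (hη : 0 < η) {k : ℕ} (hk1 : 1 ≤ k)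
    (parB : BondParY 𝔸 i) (U : CfgY 𝔸 i) (a : FBondY i → 𝔸) (f : FBondY i)
    (hunit : ∀ ι : IBondY i, qT i parB U ι f ∈ unitaryUnits 𝔸)
    (U₀ : LSite (d + 1) → Fin (d + 1) → 𝔸ˣ)
    (hreg : Reg17 (ℓ + 1) n (fun _ => (Set.univ : Set (LSite (d + 1)))) (alphaQ (d + 1) (ℓ + 1) / ((ℓ + 1 : ℕ) : ℝ) ^ 2) U₀)
    {δ₁ δ₂ C₃ : ℝ} (hδ₁ : 0 ≤ δ₁) (hδ₂ : 0 ≤ δ₂)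
    (H1 : ∀ (ι : IBondY i) (κ : Fin (d + 1)) (t : Fin 2),
      ι.1.2.src = transl (0 : Site (PV d ℓ i.m i.K hd hL) (ι.1.1 : ℕ))
        (winBase (ℓ + 1) n (rel (0 : Site (PV d ℓ i.m i.K hd hL) 0) f.src) κ t) → ι.1.2.dir = κ →
      ∀ X : 𝔸, ‖linCovIter (ℓ + 1) U₀ (bump (rel (0 : Site (PV d ℓ i.m i.K hd hL) 0) f.src) f.dir X) n
          (winBase (ℓ + 1) n (rel (0 : Site (PV d ℓ i.m i.K hd hL) 0) f.src) κ t) κ -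
        (((((ℓ + 1 : ℕ) : ℝ)) ^ n * qK i ι f : ℝ) : ℂ) • R (qT i parB U ι f) X‖ ≤ δ₁ * ‖X‖)
    (H2 : ∀ (ι : IBondY i) (t : Fin 2),
      ι.1.2.src = transl (0 : Site (PV d ℓ i.m i.K hd hL) (ι.1.1 : ℕ))
        (winBase (ℓ + 1) n (rel (0 : Site (PV d ℓ i.m i.K hd hL) 0) f.src) f.dir t) → ι.1.2.dir = f.dir →
      ‖clsField (ℓ + 1) (fun m' => torusLamb (d := d + 1) m') η n n U₀ (liftBd i a)
          (winBase (ℓ + 1) n (rel (0 : Site (PV d ℓ i.m i.K hd hL) 0) f.src) f.dir t) f.dir -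
        ((η * (((ℓ + 1 : ℕ) : ℝ)) ^ n : ℝ) : ℂ) • QY i parB U a ι‖ ≤ δ₂ * ‖a‖)
    (H3 : ∀ (κ : Fin (d + 1)) (t : Fin 2),
      ‖clsField (ℓ + 1) (fun m' => torusLamb (d := d + 1) m') η n n U₀ (liftBd i a)
          (winBase (ℓ + 1) n (rel (0 : Site (PV d ℓ i.m i.K hd hL) 0) f.src) κ t) κ‖ ≤ C₃ * ‖a‖) :
    ‖QsY i parB U (aY i (QY i parB U a)) f -
        ((i.cf * η) ^ 2 : ℝ) • descBd i (QQZdP τ (ℓ + 1) (fun m' => torusLamb (d := d + 1) m') (torusIdx (d := d + 1) hL1 ⟨η, hη, k, hk1⟩) n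
          U₀ (liftBd i a)) f‖ ≤
      (i.cf * η) ^ 2 * wQ (d := d + 1) (ℓ + 1) η n *
        (2 * ((d : ℝ) + 1) * (Cτ * betaTau τ * (δ₁ * C₃ + (((ℓ + 1 : ℕ) : ℝ)) ^ n * δ₂))) * ‖a‖ := by
  classical
  -- notation
  set y : LSite (d + 1) := rel (0 : Site (PV d ℓ i.m i.K hd hL) 0) f.src with hydef
  set μ : Fin (d + 1) := f.dir with hμdef
  set N : ℝ := (((ℓ + 1 : ℕ) : ℝ)) ^ n with hNdef
  have hN0 : 0 < N := by positivity
  have e1 : ∀ (j j' : ℕ) (w : LSite (d + 1)), j = j' →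
      rel (0 : Site (PV d ℓ i.m i.K hd hL) j) (transl (0 : Site (PV d ℓ i.m i.K hd hL) j) w) =
        rel (0 : Site (PV d ℓ i.m i.K hd hL) j') (transl (0 : Site (PV d ℓ i.m i.K hd hL) j') w) := by
    rintro j j' w rfl; rfl
  -- the index bonds over the window bonds
  choose ιOf hlev hsrc hdir using fun (κ : Fin (d + 1)) (t : Fin 2) =>
    exists_ibondY_of_constLev i hD hk (winBase (ℓ + 1) n y κ t) κ
  set V : Fin (d + 1) → Fin 2 → 𝔸 := fun κ t => QY i parB U a (ιOf κ t) with hVdef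
  set T : Fin (d + 1) → Fin 2 → 𝔸ˣ := fun κ t => qT i parB U (ιOf κ t) f with hTdef
  set q : Fin (d + 1) → Fin 2 → ℝ := fun κ t => N * qK i (ιOf κ t) f with hqdef
  -- the actual and the ideal columns ∕ class fields
  set col : Fin (d + 1) → Fin 2 → 𝔸 → 𝔸 := fun κ t X => linCovIter (ℓ + 1) U₀ (bump y μ X) n (winBase (ℓ + 1) n y κ t) κ with hcoldef
  set icol : Fin (d + 1) → Fin 2 → 𝔸 → 𝔸 := fun κ t X => ((q κ t : ℝ) : ℂ) • conjR (T κ t) X with hicoldef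
  set cls : Fin (d + 1) → Fin 2 → 𝔸 := fun κ t =>
    clsField (ℓ + 1) (fun m' => torusLamb (d := d + 1) m') η n n U₀ (liftBd i a) (winBase (ℓ + 1) n y κ t) κ with hclsdef
  set icls : Fin (d + 1) → Fin 2 → 𝔸 := fun κ t => ((η * N : ℝ) : ℂ) • V κ t with hiclsdef
  -- columns of the wrong direction have zero flat part
  have hdirv : ∀ κ t, κ ≠ μ → qK i (ιOf κ t) f = 0 := by
    intro κ t hκ
    by_contra hne
    exact hκ ((hdir κ t).symm.trans (dir_eq_of_qK_ne_zero i hne))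
  -- (H1) ∕ (H2) ∕ (H3) at the chosen index bonds
  have h1 : ∀ κ t (X : 𝔸), ‖col κ t X - icol κ t X‖ ≤ δ₁ * ‖X‖ := fun κ t X => H1 (ιOf κ t) κ t (hsrc κ t) (hdir κ t) X
  have h2 : ∀ t, ‖cls μ t - icls μ t‖ ≤ δ₂ * ‖a‖ := fun t => H2 (ιOf μ t) t (hsrc μ t) (hdir μ t)
  have h3 : ∀ κ t, ‖cls κ t‖ ≤ C₃ * ‖a‖ := fun κ t => H3 κ t
  -- the ideal column is bounded by `|q|`
  have hq1 : ∀ κ t, |q κ t| ≤ N := fun κ t => by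
    simp only [hqdef, abs_mul, abs_of_pos hN0]
    exact mul_le_of_le_one_right hN0.le (abs_qK_le_one i _ _)
  have hicol : ∀ κ t (X : 𝔸), ‖icol κ t X‖ ≤ |q κ t| * ‖X‖ := fun κ t X => by
    simp only [hicoldef, norm_smul, Complex.norm_real, Real.norm_eq_abs]
    exact mul_le_mul_of_nonneg_left (norm_R_le_of_mem_unitaryUnits (hunit _) X) (abs_nonneg _)
  -- the transpose of the ideal column (c1)
  have hicolT : ∀ κ t (v : 𝔸), entryT τ (icol κ t) v = ((q κ t : ℝ) : ℂ) • R (T κ t)⁻¹ v := fun κ t v =>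
    entryT_smul_conjR τ hτp hτt (hunit _) (q κ t) v
  -- per window bond: the actual transpose term versus the ideal one
  have hterm : ∀ κ t, ‖entryT τ (col κ t) (cls κ t) - entryT τ (icol κ t) (icls κ t)‖ ≤
      Cτ * betaTau τ * (δ₁ * C₃ + N * δ₂) * ‖a‖ := by
    intro κ t
    have hK2 : 0 ≤ |q κ t| := abs_nonneg _
    have hb := norm_entryT_pair_sub_le τ hCτ hδ₁ hK2 (h1 κ t) (hicol κ t) (cls κ t) (icls κ t)
    refine hb.trans ?_
    have hCβ : 0 ≤ Cτ * betaTau τ := by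
      have h := hCτ 1 1
      simp only [norm_one, mul_one] at h
      have hC : 0 ≤ Cτ := (abs_nonneg _).trans h
      exact mul_nonneg hC (by unfold betaTau; split_ifs <;> [exact Finset.sum_nonneg fun _ _ => mul_nonneg (norm_nonneg _) (norm_nonneg _); exact le_rfl])
    have hA : δ₁ * ‖cls κ t‖ ≤ δ₁ * C₃ * ‖a‖ := by rw [mul_assoc]; exact mul_le_mul_of_nonneg_left (h3 κ t) hδ₁
    have hB : |q κ t| * ‖cls κ t - icls κ t‖ ≤ N * δ₂ * ‖a‖ := by
      by_cases hκ : κ = μ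
      · rw [hκ]
        calc |q μ t| * ‖cls μ t - icls μ t‖ ≤ N * (δ₂ * ‖a‖) := mul_le_mul (hq1 μ t) (h2 t) (norm_nonneg _) hN0.le
          _ = N * δ₂ * ‖a‖ := by ring
      · have hq0 : q κ t = 0 := by simp only [hqdef, hdirv κ t hκ, mul_zero]
        rw [hq0, abs_zero, zero_mul]
        positivity
    calc Cτ * betaTau τ * (δ₁ * ‖cls κ t‖ + |q κ t| * ‖cls κ t - icls κ t‖)
        ≤ Cτ * betaTau τ * (δ₁ * C₃ * ‖a‖ + N * δ₂ * ‖a‖) := mul_le_mul_of_nonneg_left (add_le_add hA hB) hCβ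
      _ = Cτ * betaTau τ * (δ₁ * C₃ + N * δ₂) * ‖a‖ := by ring
  -- ===== the knit side =====
  have hK : descBd i (QQZdP τ (ℓ + 1) (fun m' => torusLamb (d := d + 1) m') (torusIdx (d := d + 1) hL1 ⟨η, hη, k, hk1⟩) n U₀ (liftBd i a)) f =
      ((wQ (d := d + 1) (ℓ + 1) η n : ℝ) : ℂ) • ∑ κ : Fin (d + 1), ∑ t : Fin 2, entryT τ (col κ t) (cls κ t) := by
    rw [descBd_apply, QQZdP_of_reg17 τ (ℓ + 1) (i := torusIdx (d := d + 1) hL1 ⟨η, hη, k, hk1⟩) hreg, Finset.sum_eq_single n]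
    · rw [← Complex.coe_smul]
      rfl
    · intro j _ hj
      show (wQ (d := d + 1) (ℓ + 1) η j) • linCovIterT τ (ℓ + 1) U₀ j
          (clsField (ℓ + 1) (fun m' => torusLamb (d := d + 1) m') η n j U₀ (liftBd i a)) y μ = 0
      rw [clsField_of_ne η hj]
      unfold linCovIterT
      simp only [Pi.zero_apply, entryT_zero', Finset.sum_const_zero, smul_zero]
    · intro h
      exact absurd (Finset.mem_range.2 (Nat.lt_succ_self n)) h
  -- ===== def-Y's side equals the ideal knit sum =====
  have hη0 : η ≠ 0 := hη.ne'
  have hwQ : wQ (d := d + 1) (ℓ + 1) η n = ((N * η) ^ 3)⁻¹ * (N ^ (d + 1) * N⁻¹) := rfl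
  have hscal : ∀ r : ℝ, r * (i.cf ^ 2 * (N ^ (d + 1) * (1 / N) ^ 2)) = (i.cf * η) ^ 2 * (wQ (d := d + 1) (ℓ + 1) η n * ((N * r) * (η * N))) := by
    intro r
    rw [hwQ]
    field_simp
  have hY : QsY i parB U (aY i (QY i parB U a)) f =
      (((i.cf * η) ^ 2 : ℝ) : ℂ) • (((wQ (d := d + 1) (ℓ + 1) η n : ℝ) : ℂ) • ∑ κ : Fin (d + 1), ∑ t : Fin 2, entryT τ (icol κ t) (icls κ t)) := by
    rw [QsY_apply i parB U]
    -- restrict to the two window bonds of direction `μ`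
    have hsupp : ∀ ι : IBondY i, qK i ι f ≠ 0 → ι ∈ Finset.image (fun t => ιOf μ t) Finset.univ := by
      intro ι hι
      obtain ⟨t, ht⟩ := src_eq_winBase_of_qK_ne_zero i hι
      have hdι := dir_eq_of_qK_ne_zero i hι
      have hlι := ibondY_level_eq i hD hk ι
      have hwb : winBase (ℓ + 1) ((ι.1.1 : ℕ)) (rel (0 : Site (PV d ℓ i.m i.K hd hL) 0) f.src) f.dir t = winBase (ℓ + 1) n y μ t := by
        rw [hlι]
      refine Finset.mem_image.2 ⟨t, Finset.mem_univ _, (ibondY_eq_of_key_eq i ?_ ?_ ?_).symm⟩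
      · rw [hlι, hlev μ t]
      · rw [ht, hsrc μ t, hwb]
        exact e1 _ _ _ (hlι.trans (hlev μ t).symm)
      · rw [hdι, hdir μ t]
    have hinj : Function.Injective fun t : Fin 2 => ιOf μ t := by
      intro t t' htt
      have ha := hsrc μ t
      have hb := hsrc μ t'
      simp only at htt
      have hkey : rel (0 : Site (PV d ℓ i.m i.K hd hL) ((ιOf μ t).1.1 : ℕ)) (ιOf μ t).1.2.src =
          rel (0 : Site (PV d ℓ i.m i.K hd hL) ((ιOf μ t').1.1 : ℕ)) (ιOf μ t').1.2.src := by rw [htt]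
      rw [ha, hb, e1 _ n _ (hlev μ t), e1 _ n _ (hlev μ t')] at hkey
      have htr := congrArg (transl (0 : Site (PV d ℓ i.m i.K hd hL) n)) hkey
      rw [transl_rel, transl_rel] at htr
      exact transl_winBase_injective (d := d) (hd := hd) (hL := hL) y μ htr
    rw [← Finset.sum_subset (Finset.subset_univ (Finset.image (fun t => ιOf μ t) Finset.univ))
      (fun ι _ hι => by
        have hq : qK i ι f = 0 := by by_contra hne; exact hι (hsupp ι hne)
        rw [hq, Complex.ofReal_zero, zero_smul]),
      Finset.sum_image (fun t _ t' _ h => hinj h)]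
    -- the ideal knit sum: only `κ = μ` survives
    rw [Finset.sum_eq_single μ]
    · rw [Finset.smul_sum, Finset.smul_sum]
      refine Finset.sum_congr rfl fun t _ => ?_
      rw [hicolT μ t, aY_apply, hw (ιOf μ t), hlev μ t, R_smul, smul_smul, ← Complex.ofReal_mul]
      simp only [hiclsdef, hqdef, hVdef, hTdef]
      rw [R_smul, smul_smul, smul_smul, smul_smul, ← Complex.ofReal_mul, ← Complex.ofReal_mul, ← Complex.ofReal_mul, hscal]
      congr 1
      push_cast
      ring
    · intro κ _ hκ
      refine Finset.sum_eq_zero fun t _ => ?_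
      rw [hicolT κ t]
      simp only [hqdef, hdirv κ t hκ, mul_zero, Complex.ofReal_zero, zero_smul]
    · intro h
      exact absurd (Finset.mem_univ _) h
  -- ===== the difference =====
  have hwq0 : 0 ≤ wQ (d := d + 1) (ℓ + 1) η n := wQ_nonneg' (d := d) (ℓ + 1) hη.le n
  rw [hY, hK, ← Complex.coe_smul, ← smul_sub, ← smul_sub, ← Finset.sum_sub_distrib, norm_smul, norm_smul, Complex.norm_real, Complex.norm_real,
    Real.norm_of_nonneg (by positivity), Real.norm_of_nonneg hwq0]
  simp_rw [← Finset.sum_sub_distrib]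
  have hsum : ‖∑ κ : Fin (d + 1), ∑ t : Fin 2, (entryT τ (icol κ t) (icls κ t) - entryT τ (col κ t) (cls κ t))‖ ≤
      2 * ((d : ℝ) + 1) * (Cτ * betaTau τ * (δ₁ * C₃ + N * δ₂)) * ‖a‖ := by
    calc ‖∑ κ : Fin (d + 1), ∑ t : Fin 2, (entryT τ (icol κ t) (icls κ t) - entryT τ (col κ t) (cls κ t))‖
        ≤ ∑ κ : Fin (d + 1), ∑ t : Fin 2, Cτ * betaTau τ * (δ₁ * C₃ + N * δ₂) * ‖a‖ := by
          refine (norm_sum_le _ _).trans (Finset.sum_le_sum fun κ _ => (norm_sum_le _ _).trans (Finset.sum_le_sum fun t _ => ?_))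
          rw [norm_sub_rev]
          exact hterm κ t
      _ = 2 * ((d : ℝ) + 1) * (Cτ * betaTau τ * (δ₁ * C₃ + N * δ₂)) * ‖a‖ := by
          rw [Finset.sum_const, Finset.sum_const, Finset.card_univ, Finset.card_univ, Fintype.card_fin, Fintype.card_fin]
          simp only [nsmul_eq_mul]
          push_cast
          ring
  calc (i.cf * η) ^ 2 * (wQ (d := d + 1) (ℓ + 1) η n *
        ‖∑ κ : Fin (d + 1), ∑ t : Fin 2, (entryT τ (icol κ t) (icls κ t) - entryT τ (col κ t) (cls κ t))‖)
      ≤ (i.cf * η) ^ 2 * (wQ (d := d + 1) (ℓ + 1) η n * (2 * ((d : ℝ) + 1) * (Cτ * betaTau τ * (δ₁ * C₃ + N * δ₂)) * ‖a‖)) :=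
        mul_le_mul_of_nonneg_left (mul_le_mul_of_nonneg_left hsum hwq0) (by positivity)
    _ = _ := by ring

/-- ★★★ **THE SAME WITH THE SHARP ENTRY SCALE** (`|Lⁿ·qK ι f| ≤ Lⁿ·L^{-n(d+1)} = L^{-nd}`, r03's `qwt_le`): the `δ₂`-term carries `L^{-nd}` instead of `Lⁿ`, so that
`ε` is UNIFORM in `n` when `δ₁ ~ α·L^{-nd}`, `C₃ ~ ηLⁿ`, `δ₂ ~ α·ηLⁿ` (the scales of [5] (147) and of the forward estimate) — THIS is the edition c4 ∕ c5 should feed.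
**THE AVERAGING CLOSENESS (c′) AT ONE FINE BOND FROM TWO COLUMN-LEVEL INEQUALITIES, SHARP.**  Data: a member of constant level `n` (nominal index `n + 1`)
with the `b₀ = 1` band weight; def-Y transporters `parB` with unitary `qT parB U ι f`; a background `U₀` in the regime `Reg17 L n ℤ^{d+1} (α_Q∕L²)` (so the
knit's letter is its printed sum); a faithful tracial `τ` with `|Re τ(x*y)| ≤ C_τ‖x‖‖y‖`; a bond function `a`, a fine bond `f = ⟨0 + y, μ⟩` (`y = rel 0 f₋`).
Hypotheses, for every index bond `ι` over a window bond `(winBase L n y κ t, κ)`: (H1) `‖LⁿQ_n(U₀)(bump y μ X)(winBase…, κ) − (Lⁿ·qK ι f)·R(qT parB U ι f)X‖ ≤ δ₁‖X‖`;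
(H2) (`κ = μ`) `‖clsField(U₀, a♯)(winBase…, μ) − ηLⁿ·(Q(U)a)(ι)‖ ≤ δ₂‖a‖`; (H3) `‖clsField(U₀, a♯)(winBase…, κ)‖ ≤ C₃‖a‖`.  Conclusion:
`‖(Q*(U)aQ(U)a)(f) − (c_fη)²·(QQZdP(U₀)a♯)♭(f)‖ ≤ (c_fη)²·w_n·(2(d+1)·C_τβ_τ·(δ₁C₃ + Lⁿδ₂))·‖a‖`.
[cite: Balaban1985BackgroundPropagators, (3.12)–(3.13) p.392, (3.16) p.393, (3.26) p.395; Balaban1985RegularSpaces, (1.58) p.86, (1.7) p.77; Balaban1985Averaging, (139)–(147) pp.39–40] -/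
theorem norm_QsY_aY_QY_sub_QQZdP_le_of_columns_sharp (hτp : ∀ a : 𝔸, a ≠ 0 → 0 < (τ (star a * a)).re) (hτt : ∀ a b : 𝔸, τ (a * b) = τ (b * a))
    {Cτ : ℝ} (hCτ : ∀ x y : 𝔸, |(τ (star x * y)).re| ≤ Cτ * ‖x‖ * ‖y‖)
    (hD : ∀ x, i.D.lev x = n) (hk : i.k = n + 1)
    (hw : ∀ ι : IBondY i, i.w ι = i.cf ^ 2 * (((((ℓ + 1 : ℕ) : ℝ)) ^ (ι.1.1 : ℕ)) ^ (d + 1) * (1 / (((ℓ + 1 : ℕ) : ℝ)) ^ (ι.1.1 : ℕ)) ^ 2))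
    (hL1 : 1 ≤ ℓ + 1) {η : ℝ} (hη : 0 < η) {k : ℕ} (hk1 : 1 ≤ k)
    (parB : BondParY 𝔸 i) (U : CfgY 𝔸 i) (a : FBondY i → 𝔸) (f : FBondY i)
    (hunit : ∀ ι : IBondY i, qT i parB U ι f ∈ unitaryUnits 𝔸)
    (U₀ : LSite (d + 1) → Fin (d + 1) → 𝔸ˣ)
    (hreg : Reg17 (ℓ + 1) n (fun _ => (Set.univ : Set (LSite (d + 1)))) (alphaQ (d + 1) (ℓ + 1) / ((ℓ + 1 : ℕ) : ℝ) ^ 2) U₀)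
    {δ₁ δ₂ C₃ : ℝ} (hδ₁ : 0 ≤ δ₁) (hδ₂ : 0 ≤ δ₂)
    (H1 : ∀ (ι : IBondY i) (κ : Fin (d + 1)) (t : Fin 2),
      ι.1.2.src = transl (0 : Site (PV d ℓ i.m i.K hd hL) (ι.1.1 : ℕ))
        (winBase (ℓ + 1) n (rel (0 : Site (PV d ℓ i.m i.K hd hL) 0) f.src) κ t) → ι.1.2.dir = κ →
      ∀ X : 𝔸, ‖linCovIter (ℓ + 1) U₀ (bump (rel (0 : Site (PV d ℓ i.m i.K hd hL) 0) f.src) f.dir X) n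
          (winBase (ℓ + 1) n (rel (0 : Site (PV d ℓ i.m i.K hd hL) 0) f.src) κ t) κ -
        (((((ℓ + 1 : ℕ) : ℝ)) ^ n * qK i ι f : ℝ) : ℂ) • R (qT i parB U ι f) X‖ ≤ δ₁ * ‖X‖)
    (H2 : ∀ (ι : IBondY i) (t : Fin 2),
      ι.1.2.src = transl (0 : Site (PV d ℓ i.m i.K hd hL) (ι.1.1 : ℕ))
        (winBase (ℓ + 1) n (rel (0 : Site (PV d ℓ i.m i.K hd hL) 0) f.src) f.dir t) → ι.1.2.dir = f.dir →
      ‖clsField (ℓ + 1) (fun m' => torusLamb (d := d + 1) m') η n n U₀ (liftBd i a)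
          (winBase (ℓ + 1) n (rel (0 : Site (PV d ℓ i.m i.K hd hL) 0) f.src) f.dir t) f.dir -
        ((η * (((ℓ + 1 : ℕ) : ℝ)) ^ n : ℝ) : ℂ) • QY i parB U a ι‖ ≤ δ₂ * ‖a‖)
    (H3 : ∀ (κ : Fin (d + 1)) (t : Fin 2),
      ‖clsField (ℓ + 1) (fun m' => torusLamb (d := d + 1) m') η n n U₀ (liftBd i a)
          (winBase (ℓ + 1) n (rel (0 : Site (PV d ℓ i.m i.K hd hL) 0) f.src) κ t) κ‖ ≤ C₃ * ‖a‖) :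
    ‖QsY i parB U (aY i (QY i parB U a)) f -
        ((i.cf * η) ^ 2 : ℝ) • descBd i (QQZdP τ (ℓ + 1) (fun m' => torusLamb (d := d + 1) m') (torusIdx (d := d + 1) hL1 ⟨η, hη, k, hk1⟩) n
          U₀ (liftBd i a)) f‖ ≤
      (i.cf * η) ^ 2 * wQ (d := d + 1) (ℓ + 1) η n *
        (2 * ((d : ℝ) + 1) * (Cτ * betaTau τ * (δ₁ * C₃ +
          ((((ℓ + 1 : ℕ) : ℝ)) ^ n * (((((ℓ + 1 : ℕ) : ℝ)) ^ (d + 1)) ^ n)⁻¹) * δ₂))) * ‖a‖ := by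
  classical
  -- notation
  set y : LSite (d + 1) := rel (0 : Site (PV d ℓ i.m i.K hd hL) 0) f.src with hydef
  set μ : Fin (d + 1) := f.dir with hμdef
  set N : ℝ := (((ℓ + 1 : ℕ) : ℝ)) ^ n with hNdef
  have hN0 : 0 < N := by positivity
  have e1 : ∀ (j j' : ℕ) (w : LSite (d + 1)), j = j' →
      rel (0 : Site (PV d ℓ i.m i.K hd hL) j) (transl (0 : Site (PV d ℓ i.m i.K hd hL) j) w) =
        rel (0 : Site (PV d ℓ i.m i.K hd hL) j') (transl (0 : Site (PV d ℓ i.m i.K hd hL) j') w) := by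
    rintro j j' w rfl; rfl
  -- the index bonds over the window bonds
  choose ιOf hlev hsrc hdir using fun (κ : Fin (d + 1)) (t : Fin 2) =>
    exists_ibondY_of_constLev i hD hk (winBase (ℓ + 1) n y κ t) κ
  set V : Fin (d + 1) → Fin 2 → 𝔸 := fun κ t => QY i parB U a (ιOf κ t) with hVdef
  set T : Fin (d + 1) → Fin 2 → 𝔸ˣ := fun κ t => qT i parB U (ιOf κ t) f with hTdef
  set q : Fin (d + 1) → Fin 2 → ℝ := fun κ t => N * qK i (ιOf κ t) f with hqdef
  -- the actual and the ideal columns ∕ class fields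
  set col : Fin (d + 1) → Fin 2 → 𝔸 → 𝔸 := fun κ t X => linCovIter (ℓ + 1) U₀ (bump y μ X) n (winBase (ℓ + 1) n y κ t) κ with hcoldef
  set icol : Fin (d + 1) → Fin 2 → 𝔸 → 𝔸 := fun κ t X => ((q κ t : ℝ) : ℂ) • conjR (T κ t) X with hicoldef
  set cls : Fin (d + 1) → Fin 2 → 𝔸 := fun κ t =>
    clsField (ℓ + 1) (fun m' => torusLamb (d := d + 1) m') η n n U₀ (liftBd i a) (winBase (ℓ + 1) n y κ t) κ with hclsdef
  set icls : Fin (d + 1) → Fin 2 → 𝔸 := fun κ t => ((η * N : ℝ) : ℂ) • V κ t with hiclsdef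
  -- columns of the wrong direction have zero flat part
  have hdirv : ∀ κ t, κ ≠ μ → qK i (ιOf κ t) f = 0 := by
    intro κ t hκ
    by_contra hne
    exact hκ ((hdir κ t).symm.trans (dir_eq_of_qK_ne_zero i hne))
  -- (H1) ∕ (H2) ∕ (H3) at the chosen index bonds
  have h1 : ∀ κ t (X : 𝔸), ‖col κ t X - icol κ t X‖ ≤ δ₁ * ‖X‖ := fun κ t X => H1 (ιOf κ t) κ t (hsrc κ t) (hdir κ t) X
  have h2 : ∀ t, ‖cls μ t - icls μ t‖ ≤ δ₂ * ‖a‖ := fun t => H2 (ιOf μ t) t (hsrc μ t) (hdir μ t)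
  have h3 : ∀ κ t, ‖cls κ t‖ ≤ C₃ * ‖a‖ := fun κ t => H3 κ t
  -- the ideal column is bounded by `|q|`
  set Nq : ℝ := N * (((((ℓ + 1 : ℕ) : ℝ)) ^ (d + 1)) ^ n)⁻¹ with hNqdef
  have hNq0 : 0 ≤ Nq := by positivity
  have hq1 : ∀ κ t, |q κ t| ≤ Nq := fun κ t => by
    simp only [hqdef, hNqdef, abs_mul, abs_of_pos hN0]
    refine mul_le_mul_of_nonneg_left ?_ hN0.le
    rw [qK_apply, abs_of_nonneg (qwt_nonneg i.hN i.D i.hk _ f)]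
    have h := qwt_le i.hN i.D i.hk (ιOf κ t) f
    have hl : B6Ineq2142KLevelV1.lvl i.hN i.D i.hk (ιOf κ t) = n := hlev κ t
    rw [hl] at h
    exact h
  have hicol : ∀ κ t (X : 𝔸), ‖icol κ t X‖ ≤ |q κ t| * ‖X‖ := fun κ t X => by
    simp only [hicoldef, norm_smul, Complex.norm_real, Real.norm_eq_abs]
    exact mul_le_mul_of_nonneg_left (norm_R_le_of_mem_unitaryUnits (hunit _) X) (abs_nonneg _)
  -- the transpose of the ideal column (c1)
  have hicolT : ∀ κ t (v : 𝔸), entryT τ (icol κ t) v = ((q κ t : ℝ) : ℂ) • R (T κ t)⁻¹ v := fun κ t v =>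
    entryT_smul_conjR τ hτp hτt (hunit _) (q κ t) v
  -- per window bond: the actual transpose term versus the ideal one
  have hterm : ∀ κ t, ‖entryT τ (col κ t) (cls κ t) - entryT τ (icol κ t) (icls κ t)‖ ≤
      Cτ * betaTau τ * (δ₁ * C₃ + Nq * δ₂) * ‖a‖ := by
    intro κ t
    have hK2 : 0 ≤ |q κ t| := abs_nonneg _
    have hb := norm_entryT_pair_sub_le τ hCτ hδ₁ hK2 (h1 κ t) (hicol κ t) (cls κ t) (icls κ t)
    refine hb.trans ?_
    have hCβ : 0 ≤ Cτ * betaTau τ := by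
      have h := hCτ 1 1
      simp only [norm_one, mul_one] at h
      have hC : 0 ≤ Cτ := (abs_nonneg _).trans h
      exact mul_nonneg hC (by unfold betaTau; split_ifs <;> [exact Finset.sum_nonneg fun _ _ => mul_nonneg (norm_nonneg _) (norm_nonneg _); exact le_rfl])
    have hA : δ₁ * ‖cls κ t‖ ≤ δ₁ * C₃ * ‖a‖ := by rw [mul_assoc]; exact mul_le_mul_of_nonneg_left (h3 κ t) hδ₁
    have hB : |q κ t| * ‖cls κ t - icls κ t‖ ≤ Nq * δ₂ * ‖a‖ := by
      by_cases hκ : κ = μ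
      · rw [hκ]
        calc |q μ t| * ‖cls μ t - icls μ t‖ ≤ Nq * (δ₂ * ‖a‖) := mul_le_mul (hq1 μ t) (h2 t) (norm_nonneg _) hNq0
          _ = Nq * δ₂ * ‖a‖ := by ring
      · have hq0 : q κ t = 0 := by simp only [hqdef, hdirv κ t hκ, mul_zero]
        rw [hq0, abs_zero, zero_mul]
        positivity
    calc Cτ * betaTau τ * (δ₁ * ‖cls κ t‖ + |q κ t| * ‖cls κ t - icls κ t‖)
        ≤ Cτ * betaTau τ * (δ₁ * C₃ * ‖a‖ + Nq * δ₂ * ‖a‖) := mul_le_mul_of_nonneg_left (add_le_add hA hB) hCβ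
      _ = Cτ * betaTau τ * (δ₁ * C₃ + Nq * δ₂) * ‖a‖ := by ring
  -- ===== the knit side =====
  have hK : descBd i (QQZdP τ (ℓ + 1) (fun m' => torusLamb (d := d + 1) m') (torusIdx (d := d + 1) hL1 ⟨η, hη, k, hk1⟩) n U₀ (liftBd i a)) f =
      ((wQ (d := d + 1) (ℓ + 1) η n : ℝ) : ℂ) • ∑ κ : Fin (d + 1), ∑ t : Fin 2, entryT τ (col κ t) (cls κ t) := by
    rw [descBd_apply, QQZdP_of_reg17 τ (ℓ + 1) (i := torusIdx (d := d + 1) hL1 ⟨η, hη, k, hk1⟩) hreg, Finset.sum_eq_single n]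
    · rw [← Complex.coe_smul]
      rfl
    · intro j _ hj
      show (wQ (d := d + 1) (ℓ + 1) η j) • linCovIterT τ (ℓ + 1) U₀ j
          (clsField (ℓ + 1) (fun m' => torusLamb (d := d + 1) m') η n j U₀ (liftBd i a)) y μ = 0
      rw [clsField_of_ne η hj]
      unfold linCovIterT
      simp only [Pi.zero_apply, entryT_zero', Finset.sum_const_zero, smul_zero]
    · intro h
      exact absurd (Finset.mem_range.2 (Nat.lt_succ_self n)) h
  -- ===== def-Y's side equals the ideal knit sum =====
  have hη0 : η ≠ 0 := hη.ne'
  have hwQ : wQ (d := d + 1) (ℓ + 1) η n = ((N * η) ^ 3)⁻¹ * (N ^ (d + 1) * N⁻¹) := rfl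
  have hscal : ∀ r : ℝ, r * (i.cf ^ 2 * (N ^ (d + 1) * (1 / N) ^ 2)) = (i.cf * η) ^ 2 * (wQ (d := d + 1) (ℓ + 1) η n * ((N * r) * (η * N))) := by
    intro r
    rw [hwQ]
    field_simp
  have hY : QsY i parB U (aY i (QY i parB U a)) f =
      (((i.cf * η) ^ 2 : ℝ) : ℂ) • (((wQ (d := d + 1) (ℓ + 1) η n : ℝ) : ℂ) • ∑ κ : Fin (d + 1), ∑ t : Fin 2, entryT τ (icol κ t) (icls κ t)) := by
    rw [QsY_apply i parB U]
    -- restrict to the two window bonds of direction `μ`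
    have hsupp : ∀ ι : IBondY i, qK i ι f ≠ 0 → ι ∈ Finset.image (fun t => ιOf μ t) Finset.univ := by
      intro ι hι
      obtain ⟨t, ht⟩ := src_eq_winBase_of_qK_ne_zero i hι
      have hdι := dir_eq_of_qK_ne_zero i hι
      have hlι := ibondY_level_eq i hD hk ι
      have hwb : winBase (ℓ + 1) ((ι.1.1 : ℕ)) (rel (0 : Site (PV d ℓ i.m i.K hd hL) 0) f.src) f.dir t = winBase (ℓ + 1) n y μ t := by
        rw [hlι]
      refine Finset.mem_image.2 ⟨t, Finset.mem_univ _, (ibondY_eq_of_key_eq i ?_ ?_ ?_).symm⟩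
      · rw [hlι, hlev μ t]
      · rw [ht, hsrc μ t, hwb]
        exact e1 _ _ _ (hlι.trans (hlev μ t).symm)
      · rw [hdι, hdir μ t]
    have hinj : Function.Injective fun t : Fin 2 => ιOf μ t := by
      intro t t' htt
      have ha := hsrc μ t
      have hb := hsrc μ t'
      simp only at htt
      have hkey : rel (0 : Site (PV d ℓ i.m i.K hd hL) ((ιOf μ t).1.1 : ℕ)) (ιOf μ t).1.2.src =
          rel (0 : Site (PV d ℓ i.m i.K hd hL) ((ιOf μ t').1.1 : ℕ)) (ιOf μ t').1.2.src := by rw [htt]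
      rw [ha, hb, e1 _ n _ (hlev μ t), e1 _ n _ (hlev μ t')] at hkey
      have htr := congrArg (transl (0 : Site (PV d ℓ i.m i.K hd hL) n)) hkey
      rw [transl_rel, transl_rel] at htr
      exact transl_winBase_injective (d := d) (hd := hd) (hL := hL) y μ htr
    rw [← Finset.sum_subset (Finset.subset_univ (Finset.image (fun t => ιOf μ t) Finset.univ))
      (fun ι _ hι => by
        have hq : qK i ι f = 0 := by by_contra hne; exact hι (hsupp ι hne)
        rw [hq, Complex.ofReal_zero, zero_smul]),
      Finset.sum_image (fun t _ t' _ h => hinj h)]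
    -- the ideal knit sum: only `κ = μ` survives
    rw [Finset.sum_eq_single μ]
    · rw [Finset.smul_sum, Finset.smul_sum]
      refine Finset.sum_congr rfl fun t _ => ?_
      rw [hicolT μ t, aY_apply, hw (ιOf μ t), hlev μ t, R_smul, smul_smul, ← Complex.ofReal_mul]
      simp only [hiclsdef, hqdef, hVdef, hTdef]
      rw [R_smul, smul_smul, smul_smul, smul_smul, ← Complex.ofReal_mul, ← Complex.ofReal_mul, ← Complex.ofReal_mul, hscal]
      congr 1
      push_cast
      ring
    · intro κ _ hκ
      refine Finset.sum_eq_zero fun t _ => ?_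
      rw [hicolT κ t]
      simp only [hqdef, hdirv κ t hκ, mul_zero, Complex.ofReal_zero, zero_smul]
    · intro h
      exact absurd (Finset.mem_univ _) h
  -- ===== the difference =====
  have hwq0 : 0 ≤ wQ (d := d + 1) (ℓ + 1) η n := wQ_nonneg' (d := d) (ℓ + 1) hη.le n
  rw [hY, hK, ← Complex.coe_smul, ← smul_sub, ← smul_sub, ← Finset.sum_sub_distrib, norm_smul, norm_smul, Complex.norm_real, Complex.norm_real,
    Real.norm_of_nonneg (by positivity), Real.norm_of_nonneg hwq0]
  simp_rw [← Finset.sum_sub_distrib]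
  have hsum : ‖∑ κ : Fin (d + 1), ∑ t : Fin 2, (entryT τ (icol κ t) (icls κ t) - entryT τ (col κ t) (cls κ t))‖ ≤
      2 * ((d : ℝ) + 1) * (Cτ * betaTau τ * (δ₁ * C₃ + Nq * δ₂)) * ‖a‖ := by
    calc ‖∑ κ : Fin (d + 1), ∑ t : Fin 2, (entryT τ (icol κ t) (icls κ t) - entryT τ (col κ t) (cls κ t))‖
        ≤ ∑ κ : Fin (d + 1), ∑ t : Fin 2, Cτ * betaTau τ * (δ₁ * C₃ + Nq * δ₂) * ‖a‖ := by
          refine (norm_sum_le _ _).trans (Finset.sum_le_sum fun κ _ => (norm_sum_le _ _).trans (Finset.sum_le_sum fun t _ => ?_))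
          rw [norm_sub_rev]
          exact hterm κ t
      _ = 2 * ((d : ℝ) + 1) * (Cτ * betaTau τ * (δ₁ * C₃ + Nq * δ₂)) * ‖a‖ := by
          rw [Finset.sum_const, Finset.sum_const, Finset.card_univ, Finset.card_univ, Fintype.card_fin, Fintype.card_fin]
          simp only [nsmul_eq_mul]
          push_cast
          ring
  calc (i.cf * η) ^ 2 * (wQ (d := d + 1) (ℓ + 1) η n *
        ‖∑ κ : Fin (d + 1), ∑ t : Fin 2, (entryT τ (icol κ t) (icls κ t) - entryT τ (col κ t) (cls κ t))‖)
      ≤ (i.cf * η) ^ 2 * (wQ (d := d + 1) (ℓ + 1) η n * (2 * ((d : ℝ) + 1) * (Cτ * betaTau τ * (δ₁ * C₃ + Nq * δ₂)) * ‖a‖)) :=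
        mul_le_mul_of_nonneg_left (mul_le_mul_of_nonneg_left hsum hwq0) (by positivity)
    _ = _ := by rw [hNqdef]; ring

end Closeness

end Literature.MathematicalPhysics.QuantumFieldTheory.Balaban1983to89.B9B8KnitAveragingClosenessOfColumns
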